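import Mathlib
import Literature.Analysis.FluidPDE.VectorCalculus
import Literature.Analysis.FluidPDE.LeiZhang2011Proofs
import Summits.NavierStokesRegularity.NavierStokesRegularity.Theorems.FilamentSkeletonRssSkeletonEquilibriumLiaCrossExpansion
import Summits.NavierStokesRegularity.NavierStokesRegularity.Theorems.FilamentSkeletonRssSkeletonEquilibriumKernelPerturbation
import Summits.NavierStokesRegularity.NavierStokesRegularity.Theorems.FilamentSkeletonRssSkeletonEquilibriumRosenheadMoments
import Summits.NavierStokesRegularity.NavierStokesRegularity.Theorems.FilamentSkeletonRssSkeletonEquilibriumRosenheadMomentBounds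
import Summits.NavierStokesRegularity.NavierStokesRegularity.Theorems.FilamentSkeletonRssSelectionBoxRJRungNearStraightTail

/-!
# Route `FilamentSkeletonRss` · crux `SelectionBoxRJ` (stmt-NavierStokesRegularity-21220) — rung tools:
# the QUANTITATIVE local-induction reduction for near-straight arcs (explicit, small constants)

Lane `ns-filament-19175-p1` (g6); completes nonlocal brick (N1) of the memo `SIGMA-SCALING-21220.md` (item evidence
#18).  Helper file `--supports stmt-NavierStokesRegularity-21220`; route-independent (no `Theses` import).

The tree's `stub_liaWindowAssembly` states the `e`-uniform local-induction asymptotics of the Rosenhead-regularised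
self-induction `S_e[X](t) = ∫ K_e(X t − X u) • X′(u) × (X t − X u) du` with an EXISTENTIAL constant
`C(c, H, κ₀, δ)` (in its proof `C = 2/(c²δ) + 2δM` with `M ≥ 4/c²`): enough for the `e → 0` limit at a fixed curve,
useless for the rung of the box, where the curve straightens with `Γ` (`κ₀, H = O(1/log Γ)` in waist units) and one
needs the remainder to be SMALL.  This file proves the quantitative version with every constant explicit and small in
the near-straight regime:

* `nearStraight_liaReduction` — for `c > 0`, `H, κ₀ ≥ 0`, `c₁ = κ₀²/4 + 2H + κ₀H + H²`, a window
  `0 < δ ≤ 1/(2c₁ + 2)` (inside the Taylor window of `stub_liaCrossExpansion`), a core `0 < e`, a `C²` unit-speed curve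
  with `‖X″‖ ≤ κ₀`, `X″` `H`-Lipschitz, chord-arc from `t` with constant `c`, and NEAR-STRAIGHT (`‖X′(u) − a‖ ≤ θ` for a
  fixed `a`, `‖a‖ ≤ 1`):
  `‖S_e[X](t) − (arsinh(δ/e) − δ/√(δ²+e²)) • X′(t) × X″(t)‖ ≤ 4θ/(c³δ) + 2δ (2H + (3/2)κ₀H + H² + 9c₁)`.
  The tail is the near-straight refinement `nearStraight_selfInductionTail` (p576446); on the window the integrand
  minus the model term `(K_e(s)s²/2) • T × N` is bounded POINTWISE by `2H + (3/2)κ₀H + H² + 9c₁` (the small branch of the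
  tree's window analysis: `stub_liaCrossExpansion` + `stub_kernelPerturbation` + `|s|³K_e(s) ≤ 1`), and the model term
  integrates exactly to the Rosenhead coefficient (`stub_rosenheadMoments`).

In the box scaling (memo §2, §5; `…RungBending`): `θ = O(Rb²)`, `κ₀, H = O(1/log Γ)`, so with `δ = 1/4` the whole
beyond-LIA self-remainder is `O(Rb² + 1/log Γ)` in waist-unit velocity, uniformly in `Γ` — the forced local-induction
model of `…RungSlipLaw` is the true in-ball skeleton equation up to that error.

HONEST FRAMING.  A kernel estimate for the rung ladder of a HYPOTHETICAL filament box; nothing here is a claim about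
Navier–Stokes regularity or blow-up.
-/

set_option linter.dupNamespace false

noncomputable section

namespace Summit.NavierStokesRegularity.NavierStokesRegularity.Theorems

open Set Function Filter MeasureTheory Real
open Literature.Analysis.FluidPDE
open Summit.NavierStokesRegularity.NavierStokesRegularity.Theorems.SkeletonEquilibrium.Sketch
open scoped InnerProductSpace Topology

namespace SelectionBoxRJRung

/-- `⟪X′(t), X″(t)⟫ = 0` along a unit-speed `C²` curve. [folklore] -/
private theorem nsl_inner_eq_zero {X : ℝ → EuclideanSpace ℝ (Fin 3)} (hX : ContDiff ℝ 2 X)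
    (hT1 : ∀ u, ‖deriv X u‖ = 1) (t : ℝ) : inner ℝ (deriv X t) (deriv (deriv X) t) = 0 := by
  -- adapted from the private `lwa_inner_eq_zero` of FilamentSkeletonRssSkeletonEquilibriumLiaWindowAssembly
  have hTd : Differentiable ℝ (deriv X) := hX.differentiable_deriv_two
  have h1 : (fun σ => inner ℝ (deriv X σ) (deriv X σ)) = fun _ => (1 : ℝ) := by
    funext σ; rw [real_inner_self_eq_norm_sq, hT1 σ, one_pow]
  have h2 : HasDerivAt (fun σ => inner ℝ (deriv X σ) (deriv X σ))
      (inner ℝ (deriv X t) (deriv (deriv X) t) + inner ℝ (deriv (deriv X) t) (deriv X t)) t :=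
    (hTd t).hasDerivAt.inner ℝ (hTd t).hasDerivAt
  rw [h1] at h2
  have h3 := h2.unique (hasDerivAt_const t (1 : ℝ))
  rw [real_inner_comm (deriv (deriv X) t)] at h3 ⊢
  linarith

/-- Chord ≤ arclength for a unit-speed `C²` curve. [folklore] -/
private theorem nsl_chord_le {X : ℝ → EuclideanSpace ℝ (Fin 3)} (hX : ContDiff ℝ 2 X)
    (hT1 : ∀ u, ‖deriv X u‖ = 1) (t u : ℝ) : ‖X u - X t‖ ≤ |u - t| := by
  -- adapted from the private `lwa_chord_le` (same file as above)
  have hXd : Differentiable ℝ X := hX.differentiable (by norm_num)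
  have h := Convex.norm_image_sub_le_of_norm_deriv_le (f := X) (C := 1) (s := Set.univ)
    (fun x _ => hXd x) (fun x _ => (hT1 x).le) convex_univ (Set.mem_univ t) (Set.mem_univ u)
  rwa [one_mul, Real.norm_eq_abs] at h

/-- First-order Taylor remainder of the tangent of a `C^{2,1}` curve. [folklore] -/
private theorem nsl_tangent_remainder {X : ℝ → EuclideanSpace ℝ (Fin 3)} {H : ℝ}
    (hX : ContDiff ℝ 2 X) (hH : 0 ≤ H)
    (hLip : ∀ u v, ‖deriv (deriv X) u - deriv (deriv X) v‖ ≤ H * |u - v|) (t u : ℝ) :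
    ‖deriv X u - deriv X t - (u - t) • deriv (deriv X) t‖ ≤ H * (u - t) ^ 2 := by
  -- adapted from the private `lwa_tangent_remainder` (same file as above)
  have hTd : Differentiable ℝ (deriv X) := hX.differentiable_deriv_two
  have hφ : ∀ r, HasDerivAt (fun r => deriv X r - deriv X t - (r - t) • deriv (deriv X) t)
      (deriv (deriv X) r - deriv (deriv X) t) r := fun r => by
    have h2 : HasDerivAt (fun r : ℝ => (r - t) • deriv (deriv X) t)
        ((1 : ℝ) • deriv (deriv X) t) r := ((hasDerivAt_id' r).sub_const t).smul_const _
    rw [one_smul] at h2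
    exact ((hTd r).hasDerivAt.sub_const _).sub h2
  have hbound : ∀ r ∈ Set.uIcc t u, ‖deriv (deriv X) r - deriv (deriv X) t‖ ≤ H * |u - t| :=
    fun r hr => (hLip r t).trans (mul_le_mul_of_nonneg_left (Set.abs_sub_left_of_mem_uIcc hr) hH)
  have hmvt := (convex_uIcc t u).norm_image_sub_le_of_norm_hasDerivWithin_le
    (fun r _ => (hφ r).hasDerivWithinAt) hbound Set.left_mem_uIcc Set.right_mem_uIcc
  have h0 : deriv X t - deriv X t - (t - t) • deriv (deriv X) t = 0 := by simp
  rw [h0, sub_zero, Real.norm_eq_abs] at hmvt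
  calc ‖deriv X u - deriv X t - (u - t) • deriv (deriv X) t‖ ≤ H * |u - t| * |u - t| := hmvt
    _ = H * (u - t) ^ 2 := by rw [mul_assoc, abs_mul_abs_self, pow_two]

/-- Second-order Taylor remainder of a `C^{2,1}` curve. [folklore] -/
private theorem nsl_chord_remainder {X : ℝ → EuclideanSpace ℝ (Fin 3)} {H : ℝ}
    (hX : ContDiff ℝ 2 X) (hH : 0 ≤ H)
    (hLip : ∀ u v, ‖deriv (deriv X) u - deriv (deriv X) v‖ ≤ H * |u - v|) (t u : ℝ) :
    ‖X u - X t - (u - t) • deriv X t - ((u - t) ^ 2 / 2) • deriv (deriv X) t‖ ≤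
      H * |u - t| ^ 3 := by
  -- adapted from the private `lwa_chord_remainder` (same file as above)
  have hXd : Differentiable ℝ X := hX.differentiable (by norm_num)
  have hψ : ∀ r, HasDerivAt
      (fun r => X r - X t - (r - t) • deriv X t - ((r - t) ^ 2 / 2) • deriv (deriv X) t)
      (deriv X r - deriv X t - (r - t) • deriv (deriv X) t) r := fun r => by
    have h2 : HasDerivAt (fun r : ℝ => (r - t) • deriv X t) ((1 : ℝ) • deriv X t) r :=
      ((hasDerivAt_id' r).sub_const t).smul_const _
    rw [one_smul] at h2
    have h3 : HasDerivAt (fun r : ℝ => (r - t) ^ 2 / 2) (r - t) r := by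
      refine ((((hasDerivAt_id' r).sub_const t).fun_pow 2).div_const 2).congr_deriv ?_
      norm_num
    exact (((hXd r).hasDerivAt.sub_const _).sub h2).sub (h3.smul_const _)
  have hbound : ∀ r ∈ Set.uIcc t u,
      ‖deriv X r - deriv X t - (r - t) • deriv (deriv X) t‖ ≤ H * (u - t) ^ 2 := fun r hr => by
    refine (nsl_tangent_remainder hX hH hLip t r).trans (mul_le_mul_of_nonneg_left ?_ hH)
    rw [← sq_abs (r - t), ← sq_abs (u - t)]
    exact pow_le_pow_left₀ (abs_nonneg _) (Set.abs_sub_left_of_mem_uIcc hr) 2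
  have hmvt := (convex_uIcc t u).norm_image_sub_le_of_norm_hasDerivWithin_le
    (fun r _ => (hψ r).hasDerivWithinAt) hbound Set.left_mem_uIcc Set.right_mem_uIcc
  have h0 : X t - X t - (t - t) • deriv X t - ((t - t) ^ 2 / 2) • deriv (deriv X) t = 0 := by simp
  rw [h0, sub_zero, Real.norm_eq_abs] at hmvt
  calc ‖X u - X t - (u - t) • deriv X t - ((u - t) ^ 2 / 2) • deriv (deriv X) t‖
      ≤ H * (u - t) ^ 2 * |u - t| := hmvt
    _ = H * |u - t| ^ 3 := by rw [← sq_abs]; ring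

/-- **The SMALL pointwise bound on the window remainder, inside the Taylor window.** For a unit vector `T`, `N`
with `‖N‖ ≤ κ₀`, `⟪T, N⟫ = 0`, a unit "tangent" `a` and a "chord" `z` at parameter distance `s` with the `C^{2,1}`
Taylor remainders `‖a − T − sN‖ ≤ H s²`, `‖z − sT − (s²/2)N‖ ≤ H|s|³`, chord ≤ arclength `‖z‖ ≤ |s|`, and
`|s| ≤ 1/(2c₁ + 2)` with `c₁ = κ₀²/4 + 2H + κ₀H + H²`, the regularised Biot–Savart integrand at `w = −z` differs from
the local-induction model term `(K_e(s) s²/2) • T × N` by at most `2H + (3/2)κ₀H + H² + 9c₁` (the small branch of the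
tree's window analysis, chord-arc not needed). [folklore] -/
theorem liaWindow_pointwise_small {s e H κ₀ : ℝ} {T N a z w : EuclideanSpace ℝ (Fin 3)}
    (he : 0 < e) (hH : 0 ≤ H) (hκ : 0 ≤ κ₀)
    (hT : ‖T‖ = 1) (hN : ‖N‖ ≤ κ₀) (hTN : inner ℝ T N = 0) (ha : ‖a‖ = 1)
    (hr₁ : ‖a - T - s • N‖ ≤ H * s ^ 2) (hr₂ : ‖z - s • T - (s ^ 2 / 2) • N‖ ≤ H * |s| ^ 3)
    (hzs : ‖z‖ ≤ |s|)
    (hs : |s| ≤ 1 / (2 * (κ₀ ^ 2 / 4 + 2 * H + κ₀ * H + H ^ 2) + 2)) (hw : w = -z) :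
    ‖((‖w‖ ^ 2 + e ^ 2) ^ (3 / 2 : ℝ))⁻¹ • cross a w -
        (((s ^ 2 + e ^ 2) ^ (3 / 2 : ℝ))⁻¹ * (s ^ 2 / 2)) • cross T N‖ ≤
      2 * H + 3 / 2 * κ₀ * H + H ^ 2 + 9 * (κ₀ ^ 2 / 4 + 2 * H + κ₀ * H + H ^ 2) := by
  -- adapted from the first branch of the private `lwa_pointwise` of …LiaWindowAssembly
  subst hw
  rw [norm_neg]
  set c₁ : ℝ := κ₀ ^ 2 / 4 + 2 * H + κ₀ * H + H ^ 2 with hc₁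
  set K₀ : ℝ := ((s ^ 2 + e ^ 2) ^ (3 / 2 : ℝ))⁻¹ with hK₀
  set Kz : ℝ := ((‖z‖ ^ 2 + e ^ 2) ^ (3 / 2 : ℝ))⁻¹ with hKz
  have hc₁0 : 0 ≤ c₁ := by rw [hc₁]; positivity
  have hq₀ : 0 < s ^ 2 + e ^ 2 := by positivity
  have hK₀0 : 0 ≤ K₀ := inv_nonneg.2 (Real.rpow_nonneg hq₀.le _)
  have hσ0 : 0 ≤ |s| := abs_nonneg s
  have hs2 : s ^ 2 = |s| ^ 2 := (sq_abs s).symm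
  have hazn : ‖cross a (-z)‖ ≤ ‖z‖ := by
    calc ‖cross a (-z)‖ ≤ ‖a‖ * ‖-z‖ := norm_cross_le_norm_mul_norm a (-z)
      _ = ‖z‖ := by rw [ha, one_mul, norm_neg]
  have hcubic : |s| ^ 3 * K₀ ≤ 1 := stub_rosenheadMomentBounds.1 e s he
  have hd0 : 0 < 2 * c₁ + 2 := by positivity
  have hs1 : |s| ≤ 1 := hs.trans (by rw [div_le_one hd0]; linarith only [hc₁0])
  obtain ⟨h1, h2⟩ := stub_liaCrossExpansion s H κ₀ T N a z hH hκ hT hN hTN hr₁ hr₂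
  have hp43 : |s| ^ 4 ≤ |s| ^ 3 := pow_le_pow_of_le_one hσ0 hs1 (by norm_num)
  have hp53 : |s| ^ 5 ≤ |s| ^ 3 := pow_le_pow_of_le_one hσ0 hs1 (by norm_num)
  have hp54 : |s| ^ 5 ≤ |s| ^ 4 := pow_le_pow_of_le_one hσ0 hs1 (by norm_num)
  have hp64 : |s| ^ 6 ≤ |s| ^ 4 := pow_le_pow_of_le_one hσ0 hs1 (by norm_num)
  have hs4 : s ^ 4 = |s| ^ 4 := (Even.pow_abs (by decide) s).symm
  have hs6 : s ^ 6 = |s| ^ 6 := (Even.pow_abs (by decide) s).symm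
  have hB₁ : 2 * H * |s| ^ 3 + 3 / 2 * κ₀ * H * s ^ 4 + H ^ 2 * |s| ^ 5 ≤
      (2 * H + 3 / 2 * κ₀ * H + H ^ 2) * |s| ^ 3 := by
    rw [hs4]
    have e1 := mul_le_mul_of_nonneg_left hp43 (by positivity : (0 : ℝ) ≤ 3 / 2 * κ₀ * H)
    have e2 := mul_le_mul_of_nonneg_left hp53 (by positivity : (0 : ℝ) ≤ H ^ 2)
    linarith only [e1, e2]
  have hρ : |‖z‖ ^ 2 - s ^ 2| ≤ c₁ * |s| ^ 4 := by
    refine h2.trans ?_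
    rw [hs4, hs6, hc₁]
    have e3 := mul_le_mul_of_nonneg_left hp54 (by positivity : (0 : ℝ) ≤ κ₀ * H)
    have e4 := mul_le_mul_of_nonneg_left hp64 (by positivity : (0 : ℝ) ≤ H ^ 2)
    linarith only [e3, e4]
  have hsmall : c₁ * |s| ^ 2 ≤ 1 / 2 := by
    have h' : |s| ^ 2 ≤ (1 / (2 * c₁ + 2)) ^ 2 := pow_le_pow_left₀ hσ0 hs 2
    calc c₁ * |s| ^ 2 ≤ c₁ * (1 / (2 * c₁ + 2)) ^ 2 := mul_le_mul_of_nonneg_left h' hc₁0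
      _ ≤ 1 / 2 := by
        rw [div_pow, one_pow, mul_one_div, div_le_div_iff₀ (pow_pos hd0 2) (by norm_num)]
        nlinarith only [hc₁0, sq_nonneg c₁]
  have hρ' : |‖z‖ ^ 2 - s ^ 2| ≤ (s ^ 2 + e ^ 2) / 2 := by
    refine hρ.trans ?_
    have hA : c₁ * |s| ^ 4 ≤ 1 / 2 * |s| ^ 2 := by
      rw [show c₁ * |s| ^ 4 = (c₁ * |s| ^ 2) * |s| ^ 2 by ring]
      exact mul_le_mul_of_nonneg_right hsmall (pow_nonneg hσ0 2)
    have hB : 1 / 2 * |s| ^ 2 ≤ (s ^ 2 + e ^ 2) / 2 := by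
      rw [← hs2]
      linarith only [sq_nonneg e]
    exact hA.trans hB
  have hpert := stub_kernelPerturbation (s ^ 2 + e ^ 2) (‖z‖ ^ 2 - s ^ 2) hq₀ hρ'
  rw [show s ^ 2 + e ^ 2 + (‖z‖ ^ 2 - s ^ 2) = ‖z‖ ^ 2 + e ^ 2 by ring] at hpert
  have hQ : 0 < (s ^ 2 + e ^ 2) ^ (5 / 2 : ℝ) := Real.rpow_pos_of_pos hq₀ _
  have h5 : |s| ^ 5 ≤ (s ^ 2 + e ^ 2) ^ (5 / 2 : ℝ) := by
    rw [Real.rpow_div_two_eq_sqrt 5 hq₀.le, Real.rpow_ofNat]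
    exact pow_le_pow_left₀ hσ0 (Real.abs_le_sqrt (le_add_of_nonneg_right (sq_nonneg e))) 5
  have hdec : Kz • cross a (-z) - (K₀ * (s ^ 2 / 2)) • cross T N =
      K₀ • (cross a (-z) - (s ^ 2 / 2) • cross T N) + (Kz - K₀) • cross a (-z) := by
    rw [smul_sub, smul_smul, sub_smul]; abel
  rw [hdec]
  have hI : ‖K₀ • (cross a (-z) - (s ^ 2 / 2) • cross T N)‖ ≤ 2 * H + 3 / 2 * κ₀ * H + H ^ 2 := by
    rw [norm_smul, Real.norm_of_nonneg hK₀0]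
    calc K₀ * ‖cross a (-z) - (s ^ 2 / 2) • cross T N‖
        ≤ K₀ * ((2 * H + 3 / 2 * κ₀ * H + H ^ 2) * |s| ^ 3) :=
          mul_le_mul_of_nonneg_left (h1.trans hB₁) hK₀0
      _ = (2 * H + 3 / 2 * κ₀ * H + H ^ 2) * (|s| ^ 3 * K₀) := by ring
      _ ≤ (2 * H + 3 / 2 * κ₀ * H + H ^ 2) * 1 :=
          mul_le_mul_of_nonneg_left hcubic (by positivity)
      _ = 2 * H + 3 / 2 * κ₀ * H + H ^ 2 := mul_one _
  have hII : ‖(Kz - K₀) • cross a (-z)‖ ≤ 9 * c₁ := by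
    rw [norm_smul, Real.norm_eq_abs]
    calc |Kz - K₀| * ‖cross a (-z)‖
        ≤ (9 * |‖z‖ ^ 2 - s ^ 2| / (s ^ 2 + e ^ 2) ^ (5 / 2 : ℝ)) * |s| :=
          mul_le_mul hpert (hazn.trans hzs) (norm_nonneg _) (by positivity)
      _ ≤ (9 * (c₁ * |s| ^ 4) / (s ^ 2 + e ^ 2) ^ (5 / 2 : ℝ)) * |s| := by gcongr
      _ = 9 * c₁ * (|s| ^ 5 / (s ^ 2 + e ^ 2) ^ (5 / 2 : ℝ)) := by ring
      _ ≤ 9 * c₁ * 1 := mul_le_mul_of_nonneg_left ((div_le_one hQ).2 h5) (by positivity)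
      _ = 9 * c₁ := mul_one _
  exact norm_add_le_of_le hI hII

/-- **Quantitative local-induction reduction for near-straight chord-arc arcs (explicit, small constants).**
See the module docstring: for `0 < δ ≤ 1/(2c₁+2)`, `c₁ = κ₀²/4 + 2H + κ₀H + H²`, and a near-straight (`θ`) chord-arc
(`c`) unit-speed `C^{2,1}` curve, the regularised self-induction at `X t` equals the local-induction term
`(arsinh(δ/e) − δ/√(δ²+e²)) • X′(t) × X″(t)` up to `4θ/(c³δ) + 2δ(2H + (3/2)κ₀H + H² + 9c₁)`, uniformly in the core
`e > 0`. [folklore] -/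
theorem nearStraight_liaReduction :
    ∀ (c H κ₀ δ θ e : ℝ) (X : ℝ → EuclideanSpace ℝ (Fin 3)) (a : EuclideanSpace ℝ (Fin 3)) (t : ℝ),
      0 < c → 0 ≤ H → 0 ≤ κ₀ → 0 < δ → δ ≤ 1 / (2 * (κ₀ ^ 2 / 4 + 2 * H + κ₀ * H + H ^ 2) + 2) → 0 < e →
      ContDiff ℝ 2 X → (∀ u, ‖deriv X u‖ = 1) → (∀ u, ‖deriv (deriv X) u‖ ≤ κ₀) →
      (∀ u v, ‖deriv (deriv X) u - deriv (deriv X) v‖ ≤ H * |u - v|) →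
      (∀ u, c * |u - t| ≤ ‖X u - X t‖) → ‖a‖ ≤ 1 → (∀ u, ‖deriv X u - a‖ ≤ θ) →
      Integrable (fun u : ℝ => ((‖X t - X u‖ ^ 2 + e ^ 2) ^ (3 / 2 : ℝ))⁻¹ • cross (deriv X u) (X t - X u)) ∧
      ‖(∫ u : ℝ, ((‖X t - X u‖ ^ 2 + e ^ 2) ^ (3 / 2 : ℝ))⁻¹ • cross (deriv X u) (X t - X u)) -
          (Real.arsinh (δ / e) - δ / Real.sqrt (δ ^ 2 + e ^ 2)) • cross (deriv X t) (deriv (deriv X) t)‖ ≤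
        4 * θ / (c ^ 3 * δ) + 2 * δ * (2 * H + 3 / 2 * κ₀ * H + H ^ 2 + 9 * (κ₀ ^ 2 / 4 + 2 * H + κ₀ * H + H ^ 2)) := by
  -- adapted from the assembly `stub_liaWindowAssembly` of …LiaWindowAssembly, with the near-straight tail and the
  -- small pointwise window bound
  intro c H κ₀ δ θ e X a t hc hH hκ hδ hδw he hX hT1 hκ₀ hLip hchord ha hθ
  set M : ℝ := 2 * H + 3 / 2 * κ₀ * H + H ^ 2 + 9 * (κ₀ ^ 2 / 4 + 2 * H + κ₀ * H + H ^ 2) with hM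
  have hM0 : 0 ≤ M := by rw [hM]; positivity
  set F : ℝ → EuclideanSpace ℝ (Fin 3) := fun u =>
    ((‖X t - X u‖ ^ 2 + e ^ 2) ^ (3 / 2 : ℝ))⁻¹ • cross (deriv X u) (X t - X u) with hF
  have hX1 : ContDiff ℝ 1 X := hX.of_le (by norm_num)
  have hXc : Continuous X := hX.continuous
  have hdc : Continuous (deriv X) := hX.continuous_deriv (by norm_num)
  have hb : ∀ u : ℝ, 0 < ‖X t - X u‖ ^ 2 + e ^ 2 := fun u => by positivity
  have hsc : Continuous fun u : ℝ => ((‖X t - X u‖ ^ 2 + e ^ 2) ^ (3 / 2 : ℝ))⁻¹ :=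
    ((((continuous_const.sub hXc).norm.pow 2).add continuous_const).rpow_const
      fun u => Or.inr (by norm_num)).inv₀ fun u => (Real.rpow_pos_of_pos (hb u) _).ne'
  have hcr : Continuous fun u : ℝ => cross (deriv X u) (X t - X u) :=
    (crossCLM.continuous.comp hdc).clm_apply (continuous_const.sub hXc)
  have hcont : Continuous F := hsc.smul hcr
  -- the tail (near-straight refinement)
  obtain ⟨htailI, htailB⟩ :=
    nearStraight_selfInductionTail e c δ θ X a t he.ne' hc hδ ha hX1 (fun u => (hT1 u).le) hθ hchord
  have hSm : MeasurableSet {u : ℝ | δ ≤ |u - t|} :=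
    (isClosed_le continuous_const
      (continuous_abs.comp (continuous_id.sub continuous_const))).measurableSet
  have hSc : {u : ℝ | δ ≤ |u - t|}ᶜ = Set.Ioo (t - δ) (t + δ) := by
    ext u
    simp only [Set.mem_compl_iff, Set.mem_setOf_eq, not_le, Set.mem_Ioo, abs_sub_lt_iff]
    constructor <;> rintro ⟨h1, h2⟩ <;> constructor <;> linarith
  have hwinI : IntegrableOn F {u : ℝ | δ ≤ |u - t|}ᶜ := by
    rw [hSc]
    exact hcont.integrableOn_Icc.mono_set Set.Ioo_subset_Icc_self
  have hInt : Integrable F := by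
    have h := integrableOn_union.2 ⟨htailI, hwinI⟩
    rwa [Set.union_compl_self, integrableOn_univ] at h
  refine ⟨hInt, ?_⟩
  -- the local-induction model term on the window
  set P : ℝ → EuclideanSpace ℝ (Fin 3) := fun u =>
    ((((u - t) ^ 2 + e ^ 2) ^ (3 / 2 : ℝ))⁻¹ * ((u - t) ^ 2 / 2)) •
      cross (deriv X t) (deriv (deriv X) t) with hP
  have hKc : Continuous fun u : ℝ => (((u - t) ^ 2 + e ^ 2) ^ (3 / 2 : ℝ))⁻¹ :=
    ((((continuous_id.sub continuous_const).pow 2).add continuous_const).rpow_const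
      fun _ => Or.inr (by norm_num)).inv₀
      fun u => (Real.rpow_pos_of_pos (by positivity : (0 : ℝ) < (u - t) ^ 2 + e ^ 2) _).ne'
  have hPc : Continuous P :=
    (hKc.mul (((continuous_id.sub continuous_const).pow 2).div_const 2)).smul continuous_const
  -- the small pointwise bound on the window
  have hptw : ∀ u ∈ Set.uIoc (t - δ) (t + δ), ‖F u - P u‖ ≤ M := fun u hu => by
    have hut : |u - t| ≤ 1 / (2 * (κ₀ ^ 2 / 4 + 2 * H + κ₀ * H + H ^ 2) + 2) := by
      rw [Set.uIoc_of_le (by linarith : t - δ ≤ t + δ)] at hu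
      have : |u - t| ≤ δ := abs_le.2 ⟨by linarith [hu.1], by linarith [hu.2]⟩
      exact this.trans hδw
    rw [hM]
    exact liaWindow_pointwise_small he hH hκ (hT1 t) (hκ₀ t) (nsl_inner_eq_zero hX hT1 t) (hT1 u)
      (nsl_tangent_remainder hX hH hLip t u) (nsl_chord_remainder hX hH hLip t u)
      (nsl_chord_le hX hT1 t u) hut (neg_sub (X u) (X t)).symm
  -- the model term integrates exactly to the Rosenhead coefficient
  have hPint : ∫ u in (t - δ)..(t + δ), P u =
      (Real.arsinh (δ / e) - δ / Real.sqrt (δ ^ 2 + e ^ 2)) •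
        cross (deriv X t) (deriv (deriv X) t) := by
    simp only [hP]
    rw [intervalIntegral.integral_smul_const]
    congr 1
    have h1 := intervalIntegral.integral_comp_sub_right (a := t - δ) (b := t + δ)
      (fun s : ℝ => ((s ^ 2 + e ^ 2) ^ (3 / 2 : ℝ))⁻¹ * (s ^ 2 / 2)) t
    rw [show t - δ - t = -δ by ring, show t + δ - t = δ by ring] at h1
    rw [h1]
    have h2 : (fun s : ℝ => ((s ^ 2 + e ^ 2) ^ (3 / 2 : ℝ))⁻¹ * (s ^ 2 / 2)) =
        fun s : ℝ => 1 / 2 * (s ^ 2 * ((s ^ 2 + e ^ 2) ^ (3 / 2 : ℝ))⁻¹) := by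
      funext s; ring
    rw [h2, intervalIntegral.integral_const_mul, stub_rosenheadMoments.2.2 e δ he hδ.le]
    ring
  have hFi : IntervalIntegrable F volume (t - δ) (t + δ) := hcont.intervalIntegrable _ _
  have hPi : IntervalIntegrable P volume (t - δ) (t + δ) := hPc.intervalIntegrable _ _
  have hwin : ∫ u in (t - δ)..(t + δ), F u =
      (Real.arsinh (δ / e) - δ / Real.sqrt (δ ^ 2 + e ^ 2)) •
          cross (deriv X t) (deriv (deriv X) t) +
        ∫ u in (t - δ)..(t + δ), (F u - P u) := by
    rw [intervalIntegral.integral_sub hFi hPi, hPint]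
    abel
  have hwinB : ‖∫ u in (t - δ)..(t + δ), (F u - P u)‖ ≤ M * (2 * δ) := by
    have h := intervalIntegral.norm_integral_le_of_norm_le_const (a := t - δ) (b := t + δ)
      (C := M) (f := fun u => F u - P u) hptw
    rwa [show t + δ - (t - δ) = 2 * δ by ring, abs_of_pos (by positivity : (0 : ℝ) < 2 * δ)] at h
  have hsplit : ∫ u, F u =
      (∫ u in {u : ℝ | δ ≤ |u - t|}, F u) + ∫ u in (t - δ)..(t + δ), F u := by
    rw [← integral_add_compl hSm hInt, hSc,
      intervalIntegral.integral_of_le (show t - δ ≤ t + δ by linarith),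
      integral_Ioc_eq_integral_Ioo]
  rw [hsplit, hwin, add_sub_assoc, add_sub_cancel_left]
  calc ‖(∫ u in {u : ℝ | δ ≤ |u - t|}, F u) + ∫ u in (t - δ)..(t + δ), (F u - P u)‖
      ≤ 4 * θ / (c ^ 3 * δ) + M * (2 * δ) := (norm_add_le _ _).trans (add_le_add htailB hwinB)
    _ = 4 * θ / (c ^ 3 * δ) + 2 * δ * M := by ring

end SelectionBoxRJRung

end Summit.NavierStokesRegularity.NavierStokesRegularity.Theorems
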